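import Literature.MathematicalPhysics.QuantumFieldTheory.Balaban1983to89.B12PolarizationTensor120
import Literature.MathematicalPhysics.QuantumFieldTheory.Balaban1983to89.B12Beta
import Literature.MathematicalPhysics.QuantumFieldTheory.Balaban1983to89.FlowStep
import Literature.MathematicalPhysics.QuantumFieldTheory.Balaban1983to89.T4Continuum

/-!
# NODE 00 (YM-PLAN Track A) — STAGE ₈, PART β: the β-FUNCTIONS OF RECORD `betaOfTerms … : FlowStep.HBeta`
# ([Balaban1987RG1] (1.20)–(1.22) p. 264) as a TOTAL DEFINITION from the two TERM FAMILIES of the effective action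
# (the coupling-free `log Z^{(k)}` of (1.3)∕(2.12) and the remainder `E^{(k+1)}` of (2.13)), in the printed ONE-LOOP SPLIT SHAPE

NODE 00 STAGE-8 MODULE, PART β (seat `pub-ymgap-dag-n09-b`, INTERIM CO-DEFINER under `pub-ymgap-node00-def` g28 per director-ym LINE №17
(E1)∕DEFINERS, 2026-08-25; design note `HOME/pub-ymgap-dag-n09-b/STAGE8-BETA-SCOPING.md`; node00-def's `STAGE5-SCOPING-g28.md` §3 row `βfun` ∕ §8
«₈ EFFECTIVE ACTION + β OF RECORD»; dag-n28-a's `BETA-PIN-LIST.md` §4 (the split must be definitional); the CONVENTIONS OF RECORD block of the root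
module `Node00.Carriers` applies).  APPEND-ONLY GROWTH: a NEW importing module; no landed module edited; the `Residual₅` field `βfun : HBeta` of
`Node00.Record5` is REPLACED at stage ₈ by `betaOfTerms F ℰ⁰ ℰ¹ ρ bV γ` once the term families `ℰ⁰`, `ℰ¹` are the ones OF RECORD
(`Node00/BackgroundActionOfRecord`, stage ₈ (a)–(c)); here they are PARAMETERS.

THE PRINT, verbatim ([Balaban1987RG1] = [I], PDF page = journal page − 248; p. 264 [PDF 16] read on the render by `B12PolarizationTensor120`'s
author and on the text layer by this seat).  *«Now we describe the most important expressions in (1.3), (1.6), the β-functions β_{j+1}(g_j). They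
are determined by the functions 𝐄^{(j+1)}(g_j, U_{j+1}) in (1.6). Let us denote 𝐄^{(j+1)}(g_j, B) = 𝐄^{(j+1)}(g_j, U_{j+1}(exp iB)). We define
Π^{ab}_{j+1,μν}(g_j, x, x′) = (δ²∕(δB^a_μ(x)δB^b_ν(x′)) 𝐄^{(j+1)})(g_j, 0). (1.20) … This implies Π^{ab}_{j+1,μν}(g_j, x, x′) = δ^{ab} Π_{j+1,μν}(g_j,
x − x′), Π_{j+1}(g_j, rb, rb′) = Π_{j+1}(g_j, b, b′), (1.21) … Now we take a limit of these functions as T^{(j+1)} ↗ Z^d. This limit exists by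
the localized representation (1.7). … β_{j+1}(g_j) = −(∂²∕∂p_μ∂p_ν Π̃_{j+1,μν})(g_j, 0) = Σ_x Π_{j+1,μν}(g_j, x) x_μ x_ν (1.22) for μ, ν arbitrary,
μ ≠ ν»*; p. 298 [PDF 50]: *«We write β_j as explicitly dependent on g_{j−1}, although it depends also on all preceding coupling constants.»*;
(2.12)–(2.14) p. 268 [PDF 20]: the new action carries `[log Z^{(k)}(U_{k+1}) − log Z^{(k)}(1)]` (coupling-free Gaussian normalisation) and the
remainder (2.13), and *«the expression under the exponential above vanishes at g_k = 0»*.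

WHAT IS DEFINED (definitions with bodies; TOTAL; junk values off-hypothesis are SAID SO; nothing of Bałaban's asserted):
* `siteOfInt F K j` — the window `ℤ⁴ → T^{(j)}` of the `K`-th approximation of the four-torus family `F` (`Site (F.P K) j = Fin 4 → ZMod (2L^{m+K−j})`).
* `polScalar ℰ ρ bV μ x ν y` — (1.20) + the `δ^{ab}` of (1.21)₁ READ AS THE DEFINITION of the scalar kernel by the NORMALISED TRACE
  `(dim 𝔤)⁻¹ Σ_a Π^{aa}_{μν}(x, y)` of `B12PolarizationTensor120.polComp ℝ (expChart ℰ ρ) bV` (the finite-volume Hessian kernel at `B = 0` of print's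
  chart `B ↦ ℰ(exp ρB)`, WITH BODY there); the identity `Π^{ab} = δ^{ab}Π` itself is the THEOREM `exists_scalar_kernel_polTensor_expChart` (G semisimple,
  scalar centroid), not used in the definition.
* `TermFamily0 F 𝔄`, `TermFamily1 F 𝔄` — the INPUT types: `ℰ⁰ k K` = «`W ↦ log Z^{(k)}(U_{k+1}(W))`» and `ℰ¹ k hist K` = «`W ↦ E^{(k+1)}(g_0, …, g_k;
  U_{k+1}(W))`» for a FREE history `hist = (g_0, …, g_k)` (p. 298), as real functionals of `𝔄`-valued unit-lattice configurations
  `W : Fin 4 → Site (F.P K) (k+1) → 𝔄` of the torus `T^{(k+1)}` of the `K`-th approximation (the background map `U_{k+1}(·)` of [15] and the analytic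
  extension (1.9) ABSORBED in the functional, exactly as in `B12PolarizationTensor120.expChart`).
* `polWindow F K j ℰ ρ bV μ ν z` — (1.21) at finite volume read at the integer separation `z` (sites `z` and `0`; translation invariance is the
  theorem `B12PolarizationTensor120.polTensor_eq_sub_zero`, not used).
* `polLimit F j ℰ ρ bV : B12Beta.Kernel 4` — **the limit «T^{(j+1)} ↗ Z^d» of (1.21), READING (c3)** (director-ym LINE №17; node00-def
  [NODE00-G28-REV1-SOUNDNESS] (c3)): INSIDE ONE family the unit-lattice torus of the `K`-th approximation at step `j` has `2L^{m+K−j}` sites per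
  direction while the fine structure `η = L^{−j}` does not depend on `K`, so the printed limit is `K → ∞`; typed as `limUnder atTop` — equal to the
  printed limit WHEN IT EXISTS (`polLimit_eq_of_tendsto`; existence = *«by the localized representation (1.7)»*, a theorem of [I]∕[II] NOT asserted
  here) and an unspecified real number otherwise.
* `beta0OfTerms`, `beta1OfTerms` — (1.22) `Σ_x Π(x) x_μ x_ν` at the pair `(μ, ν) = (0, 1)` (`B12Beta.secondMoment`, a `tsum`: `0` off summability;
  pair-independence = `B12Beta.secondMoment_pair_indep` under `PermCovariant`, a later theorem) of the limiting kernels of `ℰ⁰` (the one-loop NUMBER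
  `β⁰_{k+1}`, no coupling dependence BY TYPING) and of `ℰ¹` at the history (`β¹_{k+1}(g_0, …, g_k)`).
* **`betaOfTerms F ℰ⁰ ℰ¹ ρ bV γ : FlowStep.HBeta`** — THE β-FUNCTIONS OF RECORD in the split shape with the box convention of `FlowStepBoxExtension`
  (dag-n28-a (K3)): `β_{k+1}(v) := β⁰_{k+1} + 𝟙_{]0,γ]^{k+1}}(v)·β¹_{k+1}(v)`.  ON the box this is the printed β of the MERGED term (1.6) ((1.22) is
  additive in the kernel: `betaOfTerms_of_mem`); OFF the box (histories print never considers) the remainder is dropped — a CONVENTION, by which the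
  printed vanishing at `g_k = 0` holds by construction: **`oneLoopSplit_betaOfTerms : B12Beta.OneLoopSplit (betaOfTerms …)`** (`split` by `rfl`,
  `vanish` because a history with `g_k = 0` is off `]0, γ]^{k+1}`).  JUNK EXCLUSION (BETA-PIN-LIST §4) is honoured by typing: β is a FUNCTION of
  the term families of the effective action, never an independent residual.
* DESIGN (β) (STAGE8-BETA-SCOPING §7; reading-note (a4)∕(b1)): β from ONE merged term family `𝓝_{k+1} = A_{k+1}(·) − A_k(Ū^k(U_{k+1}(·)))` —
  `betaMerged`; the ONE-LOOP NUMBER as an OBJECT `beta0OfMerged βm v₀ k := limUnder (𝓝[>] 0) (g ↦ β_merged k (v₀ with last entry g))` ((2.13) «vanishes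
  at g_k = 0», p. 268 — junk unless the one-sided limit exists; history-independence and (AF-0) positivity are NODE O's theorems); and the β of record
  `betaOfMerged βm β0 γ k v := β⁰_k + 𝟙_{]0,γ]^{k+1}}(v)·(β_merged k v − β⁰_k)` (dag-n28-a's (K3) with a NON-TRIVIAL β⁰ — a `β⁰ := 0` convention would make every
  NODE-O road over `OneLoopSplit` with β⁰ > 0 unsatisfiable at the record): `betaOfMerged_of_mem` (= β_merged on the box), `betaOfMerged_of_notMem` (= β⁰ off it),
  **`oneLoopSplit_betaOfMerged`** (the split BY CONSTRUCTION with `β0 := β⁰`, `oneLoopSplit_betaOfMerged_β0` rfl).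
* NAMED EXISTENCE PROPERTIES (chair R434 (c3): «the existence of the limit a NAMED Prop … no convergence is asserted»): `PolLimitExists` ((1.21) «This
  limit exists») with `tendsto_polLimit`, and `Beta0LimitExists` (the `g_k → 0⁺` limit of the merged β) with `tendsto_beta0OfMerged` — definitions of the
  PROPERTIES; any crux that needs β to BE the printed limit binds them explicitly.
WHAT IS *NOT* HERE.  The term families themselves (stage ₈ (a)–(c): `A_k` by the small-field renormalisation transformations (0.17)–(0.19) as a
functional of a free history, `log Z^{(k)}` and (2.13) kept separate as print keeps them); the existence of the limit (1.21); the summability of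
(1.22) ∕ (5.10); `PermCovariant`; every ESTIMATE on β (`BetaContH`, `BetaUpperH`∕`BetaLowerH`, `RemainderConst` — NODE O ∕ K3, BETA-PIN-LIST §4
(i)–(iv)); the sign convention of (1.22)'s first equality (cell GAPS C-b12-1; only the right member is typed, as in `B12Beta`).
HONEST FRAMING: definitions + two unfolding lemmas; NO estimate, NO satisfiability claim; nothing of Bałaban's asserted; counts unmoved; one finite T⁴
programme at fixed ε per run — NOT ℝ⁴ ∕ infinite volume ∕ OS ∕ mass gap ∕ Clay.
-/

noncomputable section

namespace Literature.MathematicalPhysics.QuantumFieldTheory.Balaban1983to89.Node00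

open Filter
open T4Continuum (T4Family)
open B12PolarizationTensor120 (polComp expChart)

variable {𝔄 : Type*} [NormedRing 𝔄] [NormedAlgebra ℝ 𝔄]
variable {V : Type*} [NormedAddCommGroup V] [NormedSpace ℝ V] {ι : Type*} [Fintype ι]

/-- Integer vectors read on the unit-lattice torus `T^{(j)}` of the `K`-th approximation of the family `F` (sites
`Site (F.P K) j = Fin 4 → ZMod (2L^{m+K−j})`): the window map of the limit (1.21) «T^{(j+1)} ↗ Z^d».
[cite: Balaban1987RG1, (1.21) p.264] -/
def siteOfInt (F : T4Family) (K j : ℕ) (z : Fin 4 → ℤ) : Site (F.P K) j :=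
  fun i => ((z (Fin.cast (F.P_d K) i) : ℤ) : ZMod ((F.P K).sitesPerDir j))

/-- **(1.20)–(1.21)₁, scalar kernel at finite volume, TRACE READING**: for a term functional `ℰ` of `𝔄`-valued unit-lattice
configurations of `T^{(k+1)}` (print: `V ↦ 𝐄^{(k+1)}(g_0,…,g_k; U_{k+1}(V))`, the background map absorbed) and the chart `B ↦ exp ρB`
(`expChart`), the scalar vacuum-polarisation kernel `Π_{μν}(x, y) := (dim 𝔤)⁻¹ Σ_a Π^{aa}_{μν}(x, y)` in an (orthonormal) basis `bV` of the
charge space — print's `Π^{ab} = δ^{ab} Π` read as the DEFINITION of `Π` by the normalised trace (the identity `Π^{ab} = δ^{ab}Π` itself is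
the theorem `B12PolarizationTensor120.exists_scalar_kernel_polTensor_expChart`). [cite: Balaban1987RG1, (1.20)–(1.21) p.264] -/
def polScalar {Λ T : Type*} [Fintype Λ] [Fintype T] [DecidableEq Λ] [DecidableEq T]
    (ℰ : (Λ → T → 𝔄) → ℝ) (ρ : V →L[ℝ] 𝔄) (bV : Module.Basis ι ℝ V) (μ : Λ) (x : T) (ν : Λ) (y : T) : ℝ :=
  (Fintype.card ι : ℝ)⁻¹ * ∑ a : ι, polComp ℝ (expChart ℰ ρ) bV μ x a ν y a

/-- **The coupling-free term family** `ℰ⁰ k K` = the functional `W ↦ log Z^{(k)}(U_{k+1}(W))` of (1.3)∕(2.12) on 𝔄-valued unit-lattice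
configurations of the torus `T^{(k+1)}` of the `K`-th approximation (a Gaussian normalisation with coupling-free covariance — [Balaban1987RG1]
(1.4) p.260, (2.12) p.268; `B12Beta` Part 2): the source of the one-loop number `β⁰_{k+1}`.  INDEX DICTIONARY (dag-n28-a (b4)): the index `k` of
`ℰ⁰ k` ∕ `ℰ¹ k` is the STEP producing `A_{k+1}`; its terms are print's `log Z^{(k)}` and `E^{(k+1)}`, whose polarisation is `Π_{k+1}` and whose second moment is
`β_{k+1} = FlowStep.HBeta`'s `β k`.  INPUT of the β-layer (stage ₈ (a)–(c)); a parameter here.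
[cite: Balaban1987RG1, (1.3)–(1.4) p.260 and (2.12) p.268] -/
abbrev TermFamily0 (F : T4Family) (𝔄 : Type*) : Type _ :=
  (k : ℕ) → (K : ℕ) → ((Fin (F.P K).d → Site (F.P K) (k + 1) → 𝔄) → ℝ)

/-- **The remainder term family** `ℰ¹ k hist K` = the functional `W ↦ E^{(k+1)}(g_0,…,g_k; U_{k+1}(W))` of (2.13) p.268 for a FREE coupling history
([Balaban1987RG1] p.298: «β_j depends also on all preceding coupling constants»), on the torus `T^{(k+1)}` of the `K`-th approximation (so that `K → ∞`
IS «T^{(k+1)} ↗ Z^d» inside ONE family: `2L^{m+K−k−1}` sites per direction, fine structure `η = L^{−(k+1)}` independent of `K`).  INPUT of the β-layer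
(stage ₈ (a)–(c): A_k by the RG iteration (0.17)–(0.19) as a functional of a free history; the new term (2.13)); a parameter here.
[cite: Balaban1987RG1, (2.13) p.268 and (1.6)–(1.7) p.261] -/
abbrev TermFamily1 (F : T4Family) (𝔄 : Type*) : Type _ :=
  (k : ℕ) → (Fin (k + 1) → ℝ) → (K : ℕ) → ((Fin (F.P K).d → Site (F.P K) (k + 1) → 𝔄) → ℝ)

/-- **(1.21) at finite volume, windowed into `ℤ⁴`**: the scalar kernel of a functional on the `K`-th torus read at the integer separation `z`
(sites `z` and `0`; translation invariance `Π(x, y) = Π(x − y, 0)` is the theorem `polTensor_eq_sub_zero`, not used in the definition).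
[cite: Balaban1987RG1, (1.21) p.264] -/
def polWindow (F : T4Family) (K j : ℕ) (ℰ : (Fin (F.P K).d → Site (F.P K) j → 𝔄) → ℝ) (ρ : V →L[ℝ] 𝔄) (bV : Module.Basis ι ℝ V)
    (μ ν : Fin 4) (z : Fin 4 → ℤ) : ℝ :=
  polScalar ℰ ρ bV (Fin.cast (F.P_d K).symm μ) (siteOfInt F K j z) (Fin.cast (F.P_d K).symm ν) (siteOfInt F K j 0)

/-- **(1.21), the limit «T^{(j+1)} ↗ Z^d» — READING (c3)**: the `ℤ⁴`-kernel of a `K`-indexed family of functionals on the tori `T^{(j)}` as the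
`limUnder` along `K → ∞` of the windowed finite-volume kernels — a TOTAL definition whose value is the printed limit WHEN IT EXISTS
([Balaban1987RG1] p.264: «This limit exists by the localized representation (1.7)» — a theorem of [I]∕[II], not asserted here) and unspecified otherwise.
[cite: Balaban1987RG1, (1.21) p.264] -/
def polLimit (F : T4Family) (j : ℕ) (ℰ : (K : ℕ) → (Fin (F.P K).d → Site (F.P K) j → 𝔄) → ℝ) (ρ : V →L[ℝ] 𝔄)
    (bV : Module.Basis ι ℝ V) : B12Beta.Kernel 4 :=
  fun μ ν z => limUnder atTop (fun K : ℕ => polWindow F K j (ℰ K) ρ bV μ ν z)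

/-- **β⁰_{k+1} — the coupling-free one-loop number** (`B12Beta.OneLoopSplit.β0`): (1.22) at the pair `(0, 1)` of the limiting kernel of the
coupling-free family. [cite: Balaban1987RG1, (1.22) p.264 and (2.12) p.268] -/
def beta0OfTerms (F : T4Family) (ℰ0 : TermFamily0 F 𝔄) (ρ : V →L[ℝ] 𝔄) (bV : Module.Basis ι ℝ V) (k : ℕ) : ℝ :=
  B12Beta.secondMoment (polLimit F (k + 1) (fun K => ℰ0 k K) ρ bV) 0 1

/-- **β¹_{k+1}(g_0,…,g_k) — the remainder's contribution** (`B12Beta.OneLoopSplit.β1` before the box convention): (1.22) at the pair `(0, 1)` of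
the limiting kernel of the remainder family at the history. [cite: Balaban1987RG1, (1.22) p.264 and (2.13) p.268] -/
def beta1OfTerms (F : T4Family) (ℰ1 : TermFamily1 F 𝔄) (ρ : V →L[ℝ] 𝔄) (bV : Module.Basis ι ℝ V) (k : ℕ)
    (hist : Fin (k + 1) → ℝ) : ℝ :=
  B12Beta.secondMoment (polLimit F (k + 1) (fun K => ℰ1 k hist K) ρ bV) 0 1

/-- **(1.22) — THE β-FUNCTIONS OF RECORD** (history-dependent typing `FlowStep.HBeta`, index shift `β k ↔ β_{k+1}`), in the SPLIT SHAPE of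
`B12Beta.OneLoopSplit` with the box convention of `FlowStepBoxExtension` (§3 (K3) of dag-n28-a's BETA-PIN-LIST): `β_{k+1}(v) := β⁰_{k+1} +
𝟙_{]0,γ]^{k+1}}(v)·β¹_{k+1}(v)` — ON the box `]0, γ]^{k+1}` this is the printed β of the merged term (1.6) ((1.22) is additive in the kernel); OFF the
box (histories with a non-positive or large entry, where print defines nothing) the remainder is dropped, so that the printed vanishing at `g_k = 0`
((2.12)–(2.14) p.268) holds by construction. [cite: Balaban1987RG1, (1.22) p.264 and (2.12)–(2.14) p.268] -/
def betaOfTerms (F : T4Family) (ℰ0 : TermFamily0 F 𝔄) (ℰ1 : TermFamily1 F 𝔄) (ρ : V →L[ℝ] 𝔄) (bV : Module.Basis ι ℝ V) (γ : ℝ) :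
    FlowStep.HBeta :=
  fun k hist => beta0OfTerms F ℰ0 ρ bV k + (FlowStep.Box γ k).indicator (beta1OfTerms F ℰ1 ρ bV k) hist

/-- **The printed one-loop split holds BY CONSTRUCTION** for the β-functions of record: `β = β⁰ + 𝟙_box·β¹`, and the boxed remainder vanishes at
every history with `g_k = 0` (such a history is off the box). [cite: Balaban1987RG1, (2.12)–(2.14) p.268] -/
def oneLoopSplit_betaOfTerms (F : T4Family) (ℰ0 : TermFamily0 F 𝔄) (ℰ1 : TermFamily1 F 𝔄) (ρ : V →L[ℝ] 𝔄)
    (bV : Module.Basis ι ℝ V) (γ : ℝ) : B12Beta.OneLoopSplit (betaOfTerms F ℰ0 ℰ1 ρ bV γ) where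
  β0 := beta0OfTerms F ℰ0 ρ bV
  β1 k := (FlowStep.Box γ k).indicator (beta1OfTerms F ℰ1 ρ bV k)
  split _ _ := rfl
  vanish k p hp := by
    refine Set.indicator_of_notMem ?_ _
    intro hmem
    have h := (FlowStep.mem_box.mp hmem) (Fin.last k)
    rw [hp] at h
    exact lt_irrefl 0 h.1

/-- Unfolding on the box: for a history in `]0, γ]^{k+1}` the β-function of record IS `β⁰_{k+1} + β¹_{k+1}(v)` = the printed second moment (1.22) of
the limiting kernels of both term families. [cite: Balaban1987RG1, (1.22) p.264] -/
theorem betaOfTerms_of_mem (F : T4Family) (ℰ0 : TermFamily0 F 𝔄) (ℰ1 : TermFamily1 F 𝔄) (ρ : V →L[ℝ] 𝔄)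
    (bV : Module.Basis ι ℝ V) (γ : ℝ) {k : ℕ} {hist : Fin (k + 1) → ℝ} (h : hist ∈ FlowStep.Box γ k) :
    betaOfTerms F ℰ0 ℰ1 ρ bV γ k hist = beta0OfTerms F ℰ0 ρ bV k + beta1OfTerms F ℰ1 ρ bV k hist := by
  simp [betaOfTerms, Set.indicator_of_mem h]

/-- If the finite-volume kernels converge as `K → ∞` (the printed limit (1.21) exists), `polLimit` IS that limit.
[cite: Balaban1987RG1, (1.21) p.264] -/
theorem polLimit_eq_of_tendsto (F : T4Family) (j : ℕ) (ℰ : (K : ℕ) → (Fin (F.P K).d → Site (F.P K) j → 𝔄) → ℝ)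
    (ρ : V →L[ℝ] 𝔄) (bV : Module.Basis ι ℝ V) {μ ν : Fin 4} {z : Fin 4 → ℤ} {P : ℝ}
    (h : Tendsto (fun K : ℕ => polWindow F K j (ℰ K) ρ bV μ ν z) atTop (nhds P)) :
    polLimit F j ℰ ρ bV μ ν z = P :=
  h.limUnder_eq

/-! ## Design (β): β from ONE merged term family, with the one-loop number as a `limUnder (𝓝[>] 0)` object
(dag-n28-a [DAGN28A-G2-…TRAP IN (β3)]: `β⁰ := 0` would make every NODE-O road over `OneLoopSplit` with `β⁰ > 0` UNSATISFIABLE at the record —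
any β vanishing on the hyperplane `g_k = 0` admits only `β⁰ ≡ 0` splits; hence the one-loop number must be a non-trivial OBJECT and the box
convention must interpolate to IT, not to `0`.) -/

/-- **β_merged** — (1.22) of the limiting kernel of ONE term family (design (β): `ℰ k hist K` = the MERGED new term
`𝓝_{k+1} = A_{k+1}(·) − A_k(Ū^k(U_{k+1}(·)))` of (1.6), STAGE8-BETA-SCOPING §7). [cite: Balaban1987RG1, (1.22) p.264 and (1.6) p.261] -/
def betaMerged (F : T4Family) (ℰ : TermFamily1 F 𝔄) (ρ : V →L[ℝ] 𝔄) (bV : Module.Basis ι ℝ V) : FlowStep.HBeta :=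
  fun k hist => B12Beta.secondMoment (polLimit F (k + 1) (fun K => ℰ k hist K) ρ bV) 0 1

/-- **The one-loop number `β⁰_{k+1}` as an OBJECT under design (β)**: the limit of `β_merged(g_0, …, g_{k−1}, g)` as the LAST coupling `g → 0⁺`
at a reference history `v₀` — print: the remainder (2.13) «vanishes at g_k = 0» (p. 268), so the `g_k → 0` limit of the merged β isolates the
coupling-free (log Z^{(k)}) number; typed as `limUnder (𝓝[>] 0)` (junk unless the one-sided limit exists; history-independence of the limit and
its positivity (AF-0) are NODE O's theorems, never the definer's). [cite: Balaban1987RG1, (2.12)–(2.14) p.268 and (1.22) p.264] -/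
def beta0OfMerged (βm : FlowStep.HBeta) (v₀ : (k : ℕ) → (Fin (k + 1) → ℝ)) (k : ℕ) : ℝ :=
  limUnder (nhdsWithin (0 : ℝ) (Set.Ioi 0)) (fun g : ℝ => βm k (Function.update (v₀ k) (Fin.last k) g))

/-- **THE β-FUNCTIONS OF RECORD under design (β)** — the box convention interpolating to the ONE-LOOP NUMBER (dag-n28-a's (K3) with a non-trivial
`β⁰`): `β_{k+1}(v) := β⁰_{k+1} + 𝟙_{]0,γ]^{k+1}}(v)·(β_merged(v) − β⁰_{k+1})` — EQUAL to `β_merged` ON the box, to `β⁰` OFF it.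
[cite: Balaban1987RG1, (1.22) p.264 and (2.12)–(2.14) p.268] -/
def betaOfMerged (βm : FlowStep.HBeta) (β0 : ℕ → ℝ) (γ : ℝ) : FlowStep.HBeta :=
  fun k v => β0 k + (FlowStep.Box γ k).indicator (fun w => βm k w - β0 k) v

/-- On the box the β of record IS the merged β. [cite: Balaban1987RG1, (1.22) p.264] -/
theorem betaOfMerged_of_mem (βm : FlowStep.HBeta) (β0 : ℕ → ℝ) (γ : ℝ) {k : ℕ} {v : Fin (k + 1) → ℝ}
    (h : v ∈ FlowStep.Box γ k) : betaOfMerged βm β0 γ k v = βm k v := by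
  simp [betaOfMerged, Set.indicator_of_mem h]

/-- Off the box the β of record IS the one-loop number. [cite: Balaban1987RG1, (2.12)–(2.14) p.268] -/
theorem betaOfMerged_of_notMem (βm : FlowStep.HBeta) (β0 : ℕ → ℝ) (γ : ℝ) {k : ℕ} {v : Fin (k + 1) → ℝ}
    (h : v ∉ FlowStep.Box γ k) : betaOfMerged βm β0 γ k v = β0 k := by
  simp [betaOfMerged, Set.indicator_of_notMem h]

/-- **The printed one-loop split BY CONSTRUCTION with the NON-TRIVIAL one-loop number**: `OneLoopSplit (betaOfMerged βm β0 γ)` with `β0 := β0`,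
`β1 := 𝟙_box·(β_merged − β⁰)` (vanish: a history with `g_k = 0` is off the box). [cite: Balaban1987RG1, (2.12)–(2.14) p.268] -/
def oneLoopSplit_betaOfMerged (βm : FlowStep.HBeta) (β0 : ℕ → ℝ) (γ : ℝ) : B12Beta.OneLoopSplit (betaOfMerged βm β0 γ) where
  β0 := β0
  β1 k := (FlowStep.Box γ k).indicator (fun w => βm k w - β0 k)
  split _ _ := rfl
  vanish k p hp := by
    refine Set.indicator_of_notMem ?_ _
    intro hmem
    have h := (FlowStep.mem_box.mp hmem) (Fin.last k)
    rw [hp] at h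
    exact lt_irrefl 0 h.1

/-- The split's one-loop field IS the given number (so a record built with `β0 := beta0OfMerged …` carries THAT number in every `OneLoopSplit`-consumer).
[cite: Balaban1987RG1, (2.12)–(2.14) p.268] -/
theorem oneLoopSplit_betaOfMerged_β0 (βm : FlowStep.HBeta) (β0 : ℕ → ℝ) (γ : ℝ) :
    (oneLoopSplit_betaOfMerged βm β0 γ).β0 = β0 := rfl

/-! ## The existence clauses as NAMED `Prop`s (chair R434 (c3): «the existence of the limit a NAMED Prop … an explicit hypothesis binder of any
crux that needs β to BE the limit; no convergence is asserted») -/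

/-- **«This limit exists» ((1.21), p. 264) as a NAMED property** of a `K`-indexed family of functionals: every windowed finite-volume kernel converges
as `K → ∞`.  An ESTIMATE of print ([I] p. 264 «by the localized representation (1.7)»; [III] §3) — a definition of the PROPERTY, never asserted.
[cite: Balaban1987RG1, (1.21) p.264] -/
def PolLimitExists (F : T4Family) (j : ℕ) (ℰ : (K : ℕ) → (Fin (F.P K).d → Site (F.P K) j → 𝔄) → ℝ) (ρ : V →L[ℝ] 𝔄)
    (bV : Module.Basis ι ℝ V) : Prop :=
  ∀ (μ ν : Fin 4) (z : Fin 4 → ℤ), ∃ P : ℝ, Tendsto (fun K : ℕ => polWindow F K j (ℰ K) ρ bV μ ν z) atTop (nhds P)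

/-- Under the named existence property, `polLimit` IS the limit of the finite-volume kernels (so β of record IS the printed (1.22) of the limiting kernel).
[cite: Balaban1987RG1, (1.21)–(1.22) p.264] -/
theorem tendsto_polLimit (F : T4Family) (j : ℕ) (ℰ : (K : ℕ) → (Fin (F.P K).d → Site (F.P K) j → 𝔄) → ℝ) (ρ : V →L[ℝ] 𝔄)
    (bV : Module.Basis ι ℝ V) (h : PolLimitExists F j ℰ ρ bV) (μ ν : Fin 4) (z : Fin 4 → ℤ) :
    Tendsto (fun K : ℕ => polWindow F K j (ℰ K) ρ bV μ ν z) atTop (nhds (polLimit F j ℰ ρ bV μ ν z)) :=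
  tendsto_nhds_limUnder (h μ ν z)

omit [NormedRing 𝔄] [NormedAlgebra ℝ 𝔄] [NormedAddCommGroup V] [NormedSpace ℝ V] [Fintype ι] in
/-- **«vanishes at g_k = 0» read as a one-sided limit, as a NAMED property**: at the reference history the merged β has a limit as the last coupling
`g → 0⁺`, for every step.  An ESTIMATE (continuity of β at the face `g_k = 0`: [I] p. 264 β-clause ∕ p. 268) — a definition of the PROPERTY, never asserted.
[cite: Balaban1987RG1, (2.12)–(2.14) p.268 and p.264 (β-clause)] -/
def Beta0LimitExists (βm : FlowStep.HBeta) (v₀ : (k : ℕ) → (Fin (k + 1) → ℝ)) : Prop :=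
  ∀ k : ℕ, ∃ b : ℝ, Tendsto (fun g : ℝ => βm k (Function.update (v₀ k) (Fin.last k) g)) (nhdsWithin (0 : ℝ) (Set.Ioi 0)) (nhds b)

omit [NormedRing 𝔄] [NormedAlgebra ℝ 𝔄] [NormedAddCommGroup V] [NormedSpace ℝ V] [Fintype ι] in
/-- Under the named property, `beta0OfMerged` IS the `g_k → 0⁺` limit of the merged β. [cite: Balaban1987RG1, (2.12)–(2.14) p.268] -/
theorem tendsto_beta0OfMerged (βm : FlowStep.HBeta) (v₀ : (k : ℕ) → (Fin (k + 1) → ℝ)) (h : Beta0LimitExists βm v₀) (k : ℕ) :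
    Tendsto (fun g : ℝ => βm k (Function.update (v₀ k) (Fin.last k) g)) (nhdsWithin (0 : ℝ) (Set.Ioi 0))
      (nhds (beta0OfMerged βm v₀ k)) :=
  tendsto_nhds_limUnder (h k)

end Literature.MathematicalPhysics.QuantumFieldTheory.Balaban1983to89.Node00
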